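import Summits.QuantumFields.BalabanUV.Beta.EriceRemainderEnclosureHistoryRenewalRate
import Literature.MathematicalPhysics.QuantumFieldTheory.Balaban1983to89.T4ContinuumCoupling

/-!
# EriceRemainderEnclosureHistoryRenewalContinuum — (E33d) THE CONTINUUM RECURSION VARIABLE AND NODE U6'S CAUCHY SUM WITHOUT
# `FadingMemory`: the stretched-exponential matching rate of (E33c) is SUMMABLE over the cutoff at every fixed infrared distance

Cell `pub-balaban`, β-function sub-cell, BINDER row D4 «RemainderConst leaves for Bałaban's split» (`HOME/BINDER-OWNERS.md`; owner
lineage `b2b-balaban-beta-an4`; this file by co-owner #2 lineage `b2b-balaban-beta-d4-p2`, generation 35), β-FLOW TEAM duty (1),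
FREEZE (0) honoured (def-free; no new leaf, no new hypothesis shape).  The consequences of station (E33) at a fixed infrared distance,
in the vocabulary of node U2's `T4ContinuumCoupling` (lineage `t4-ne4-p2`; `invSq`, `astar`, `abs_invSq_succ_sub`, `invSq_flow` BY NAME)
and node U6's `T4CauchySum` (`delta`, `summable_succ_pow_mul_geometric` BY NAME); run-level input (E33c)
`EriceRemainderEnclosureHistoryRenewalRate.disc_le_stretched_sign` ∕ `disc_le_stretched_eventual`.

HONEST FRAMING (page 1, verbatim and binding).  *"Discharging BetaPertH makes Bałaban's UV stability UNCONDITIONAL — a real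
constructive-QFT result; it is NOT the continuum limit and NOT the Clay problem."*  THIS FILE DISCHARGES NOTHING OF THE KIND.
«CONTINUUM» here = the limit, as the cutoff index `K → ∞` at a fixed number `m` of scales above the infrared end, of the recursion
variable `1∕g²` of the SCALAR recursion (0.20) for an ABSTRACT family `β : FlowStep.HBeta` under NAMED BINDERS (node U2's
`ScaleShiftRate`, `HistLipschitz` with a row total weight, `EventualLowerH`, the sign or the two-sided bound — NOT PRINTED, GAPS
G-t4-U2-1∕-2, NOT asserted for [I] (1.22)); NOT a continuum limit of any expectation of Bałaban's model.  Nothing of [I] is quoted newly.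
Row D4 class UNCHANGED (critical-path width 0; instance 0∕1; D4 DISCHARGE NO DATE).  HONEST DEPENDENCY: continuum YM on T⁴ ⇐ BetaPertH ∧
nine spine estimates (0/9 proved); BetaPertH ⇐ (D1) ∧ (D4) ∧ CAP+tail; G-an2-4 gates asym, D1 and NE2/3/4.

THE POINT (census sense (α)).  `T4ContinuumCoupling` derives the existence of `astar g m = lim_n 1∕(g (n+m) n)²` (and everything after
it) from node U2's output SHAPE `InjectedRate C 0 θ (fun K j ↦ disc (g K) (g (K+1)) j)`, i.e. from `FadingMemory` through
`disc_le_of_fadingMemory`; `T4CauchySum.summable_delta` likewise.  Under (E33c)'s stretched shape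
`disc (g K) (g (K+1)) j ≤ D·(2K+2)·r^(Nat.sqrt j)` (`r = max(θ, q) < 1`) — obtained WITHOUT `FadingMemory` — the consecutive-cutoff
differences at infrared distance `m` are `≤ 2D(m+1)·(n+1)·r^(Nat.sqrt n)`, a summable sequence (§1: `(n+1)³·r^(Nat.sqrt n)` is bounded by
the geometric-polynomial sum `Σ_s (s+1)⁶ r^s` since `n + 1 ≤ (⌊√n⌋+1)²`), so the recursion variables converge scale by scale (§2), the
limit flow holds (§2), and node U6's transported total `delta E ρ` is summable over the cutoff (§3: a Cauchy product of two summable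
sequences).  So, along the history channel: EXISTENCE of the continuum recursion variable costs the ROW total weight + the floor + NE4
as typed; the decay of the memory buys the geometric TAIL `Cθ^n∕(1−θ)` of `T4ContinuumCoupling.abs_invSq_sub_astar_le` and the K-uniform
constant — rates, not existence.

WHAT IS PROVED ([folklore] real analysis + by-name composition; 0 `def`, 0 sorry; nothing of [I] asserted).
 §1 `exists_bound_pow_three_mul_pow_sqrt`, `summable_succ_mul_pow_sqrt` — `Σ_n (n+1)·r^(Nat.sqrt n) < ∞` for `0 ≤ r < 1`.
 §2 From the stretched SHAPE (hypothesis `hstr`): `summable_disc_of_stretched` (fixed infrared distance), `tendsto_invSq_of_stretched`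
    (`invSq g m n → astar g m`), `tendsto_beta_diag_of_stretched` (limit flow: the diagonal β-values converge to `astar g (m+1) − astar g m`).
 §3 `summable_delta_of_stretched` — node U6's `T4CauchySum.delta E ρ (fun K j ↦ disc (g K) (g (K+1)) j)` is summable over `K`;
    `cauchySum_of_stretched` — node U6's assembled `cauchySum` conclusions (Cauchy ∕ uniform convergence of the generating functions) from
    the stretched shape + node U5's `MatchingModConstants`, BY NAME.
 §4 ENDS from the binders, NO `FadingMemory`: **`continuum_of_sign`** ∕ `summable_delta_of_sign` (sign + eventual floor, `M·U < 1`),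
    **`continuum_of_eventual`** (eventual floor + two-sided bound + `k₀β′γ² ≤ 1∕2`, `2√2·M·U < 1`), `U = (k₀+1)γ³ + 2γ∕b`.
-/

noncomputable section
open Finset Filter Topology

namespace Summit.QuantumFields.BalabanUV.Beta.EriceRemainderEnclosureHistoryRenewalContinuum

open Literature.MathematicalPhysics.QuantumFieldTheory.Balaban1983to89
open Literature.MathematicalPhysics.QuantumFieldTheory.Balaban1983to89.FlowStep
open Literature.MathematicalPhysics.QuantumFieldTheory.Balaban1983to89.T4CouplingMatching
open Literature.MathematicalPhysics.QuantumFieldTheory.Balaban1983to89.T4ContinuumCoupling (invSq astar abs_invSq_succ_sub invSq_flow)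
open Literature.MathematicalPhysics.QuantumFieldTheory.Balaban1983to89.T4CauchySum
  (delta summable_succ_pow_mul_geometric MatchingModConstants genFun genFunLim abs_genFun_succ_sub_le cauchySeq_genFun
    tendstoUniformlyOn_genFun)
open Summit.QuantumFields.BalabanUV.Beta.EriceRemainderEnclosureHistoryRenewalRate
  (disc_le_stretched_sign disc_le_stretched_eventual)

/-! ## §1 The stretched-exponential sequence is summable against a linear weight -/

/-- `(n+1)³·r^(Nat.sqrt n)` is bounded for `0 ≤ r < 1`: with `s = Nat.sqrt n`, `n + 1 ≤ (s+1)²` (`Nat.succ_le_succ_sqrt`), so the term is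
`≤ (s+1)⁶ r^s ≤ Σ_s (s+1)⁶ r^s` (node U6's `summable_succ_pow_mul_geometric` BY NAME). [folklore] -/
theorem exists_bound_pow_three_mul_pow_sqrt {r : ℝ} (hr0 : 0 ≤ r) (hr1 : r < 1) :
    ∃ B : ℝ, 0 ≤ B ∧ ∀ n : ℕ, ((n : ℝ) + 1) ^ 3 * r ^ Nat.sqrt n ≤ B := by
  have hsum := summable_succ_pow_mul_geometric hr0 hr1 6
  have hnn : ∀ s : ℕ, 0 ≤ ((s : ℝ) + 1) ^ 6 * r ^ s := fun s => by positivity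
  refine ⟨∑' s : ℕ, ((s : ℝ) + 1) ^ 6 * r ^ s, tsum_nonneg hnn, fun n => ?_⟩
  have hn : (n : ℝ) + 1 ≤ ((Nat.sqrt n : ℝ) + 1) * ((Nat.sqrt n : ℝ) + 1) := by
    exact_mod_cast Nat.succ_le_succ_sqrt n
  have h3 : ((n : ℝ) + 1) ^ 3 ≤ ((Nat.sqrt n : ℝ) + 1) ^ 6 := by
    calc ((n : ℝ) + 1) ^ 3 ≤ (((Nat.sqrt n : ℝ) + 1) * ((Nat.sqrt n : ℝ) + 1)) ^ 3 :=
          pow_le_pow_left₀ (by positivity) hn 3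
      _ = ((Nat.sqrt n : ℝ) + 1) ^ 6 := by ring
  calc ((n : ℝ) + 1) ^ 3 * r ^ Nat.sqrt n ≤ ((Nat.sqrt n : ℝ) + 1) ^ 6 * r ^ Nat.sqrt n :=
        mul_le_mul_of_nonneg_right h3 (pow_nonneg hr0 _)
    _ ≤ ∑' s : ℕ, ((s : ℝ) + 1) ^ 6 * r ^ s := hsum.le_tsum (Nat.sqrt n) (fun s _ => hnn s)

/-- **`Σ_n (n+1)·r^(Nat.sqrt n) < ∞`** for `0 ≤ r < 1` (comparison with `B∕(n+1)²`). [folklore] -/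
theorem summable_succ_mul_pow_sqrt {r : ℝ} (hr0 : 0 ≤ r) (hr1 : r < 1) :
    Summable (fun n : ℕ => ((n : ℝ) + 1) * r ^ Nat.sqrt n) := by
  obtain ⟨B, hB0, hB⟩ := exists_bound_pow_three_mul_pow_sqrt hr0 hr1
  have h2 : Summable (fun n : ℕ => 1 / ((n : ℝ) + 1) ^ 2) := by
    have h := (summable_nat_add_iff 1).mpr (Real.summable_one_div_nat_pow.mpr one_lt_two)
    simpa [Nat.cast_add, Nat.cast_one] using h
  refine Summable.of_nonneg_of_le (fun n => by positivity) (fun n => ?_) (h2.mul_left B)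
  have hn1 : (0 : ℝ) < (n : ℝ) + 1 := by positivity
  rw [mul_one_div, le_div_iff₀ (pow_pos hn1 2)]
  calc ((n : ℝ) + 1) * r ^ Nat.sqrt n * ((n : ℝ) + 1) ^ 2 = ((n : ℝ) + 1) ^ 3 * r ^ Nat.sqrt n := by ring
    _ ≤ B := hB n

/-! ## §2 From the stretched shape: summability at a fixed infrared distance, the continuum recursion variable, the limit flow -/

variable {β : HBeta} {g : ℕ → ℕ → ℝ} {γ gIR D r : ℝ}

/-- **SUMMABILITY AT A FIXED INFRARED DISTANCE.**  If a family of runs `K ↦ g K` has the stretched matching shape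
`disc (g K) (g (K+1)) j ≤ D·(2K+2)·r^(Nat.sqrt j)` (`j ≤ K`; `D ≥ 0`, `0 ≤ r < 1`) — (E33c)'s conclusion, NO `FadingMemory` — then at every
infrared distance `m` the consecutive-cutoff discrepancies `n ↦ disc (g (n+m)) (g (n+m+1)) n` are summable
(`≤ 2D(m+1)·(n+1)·r^(Nat.sqrt n)`, §1). [folklore] -/
theorem summable_disc_of_stretched (hD : 0 ≤ D) (hr0 : 0 ≤ r) (hr1 : r < 1)
    (hstr : ∀ K j, j ≤ K → disc (g K) (g (K + 1)) j ≤ D * (2 * K + 2) * r ^ Nat.sqrt j) (m : ℕ) :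
    Summable (fun n : ℕ => disc (g (n + m)) (g (n + m + 1)) n) := by
  refine Summable.of_nonneg_of_le (fun n => disc_nonneg _ _ _) (fun n => ?_)
    ((summable_succ_mul_pow_sqrt hr0 hr1).mul_left (2 * D * ((m : ℝ) + 1)))
  have h := hstr (n + m) n (Nat.le_add_right n m)
  have hK : (2 * ((n + m : ℕ) : ℝ) + 2) ≤ 2 * ((m : ℝ) + 1) * ((n : ℝ) + 1) := by
    push_cast; nlinarith [(Nat.cast_nonneg n : (0 : ℝ) ≤ (n : ℝ)), (Nat.cast_nonneg m : (0 : ℝ) ≤ (m : ℝ))]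
  calc disc (g (n + m)) (g (n + m + 1)) n ≤ D * (2 * ((n + m : ℕ) : ℝ) + 2) * r ^ Nat.sqrt n := h
    _ ≤ D * (2 * ((m : ℝ) + 1) * ((n : ℝ) + 1)) * r ^ Nat.sqrt n :=
        mul_le_mul_of_nonneg_right (mul_le_mul_of_nonneg_left hK hD) (pow_nonneg hr0 _)
    _ = 2 * D * ((m : ℝ) + 1) * (((n : ℝ) + 1) * r ^ Nat.sqrt n) := by ring

/-- **THE RECURSION VARIABLES CONVERGE AS THE CUTOFF IS REMOVED, scale by scale, WITHOUT `FadingMemory`**: under the stretched shape,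
`invSq g m n = 1∕(g (n+m) n)² → astar g m` (`T4ContinuumCoupling.astar`, the intrinsic `limUnder`; consecutive differences
`|invSq g m (n+1) − invSq g m n| = disc (g (n+m)) (g (n+m+1)) n` are summable, hence the sequence is Cauchy in `ℝ`). [folklore] -/
theorem tendsto_invSq_of_stretched (hD : 0 ≤ D) (hr0 : 0 ≤ r) (hr1 : r < 1)
    (hstr : ∀ K j, j ≤ K → disc (g K) (g (K + 1)) j ≤ D * (2 * K + 2) * r ^ Nat.sqrt j) (m : ℕ) :
    Tendsto (invSq g m) atTop (𝓝 (astar g m)) := by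
  have hsum := summable_disc_of_stretched hD hr0 hr1 hstr m
  have hcau : CauchySeq (invSq g m) := by
    refine cauchySeq_of_summable_dist (hsum.congr fun n => ?_)
    rw [Real.dist_eq, abs_sub_comm, abs_invSq_succ_sub]
  obtain ⟨a, ha⟩ := cauchySeq_tendsto_of_complete hcau
  exact tendsto_nhds_limUnder ⟨a, ha⟩

/-- **THE LIMIT FLOW WITHOUT `FadingMemory`**: under the stretched shape and the run-wise recursion (0.20) (`∀ K, RGEqH K β (g K)`), the
diagonal β-values `β n (g (n+m+1))_{0..n}` converge to `astar g (m+1) − astar g m` (`T4ContinuumCoupling.invSq_flow` BY NAME: they equal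
`invSq g (m+1) n − invSq g m (n+1)`). [cite: Balaban1987RG1, (0.20) p.256] -/
theorem tendsto_beta_diag_of_stretched (hD : 0 ≤ D) (hr0 : 0 ≤ r) (hr1 : r < 1)
    (hstr : ∀ K j, j ≤ K → disc (g K) (g (K + 1)) j ≤ D * (2 * K + 2) * r ^ Nat.sqrt j)
    (hrun : ∀ K, RGEqH K β (g K)) (m : ℕ) :
    Tendsto (fun n => β n (prefixOf (g (n + m + 1)) n)) atTop (𝓝 (astar g (m + 1) - astar g m)) := by
  have h1 := tendsto_invSq_of_stretched hD hr0 hr1 hstr (m + 1)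
  have h2 := (tendsto_invSq_of_stretched hD hr0 hr1 hstr m).comp (tendsto_add_atTop_nat 1)
  refine ((h1.sub h2).congr fun n => ?_)
  show invSq g (m + 1) n - invSq g m (n + 1) = β n (prefixOf (g (n + m + 1)) n)
  rw [invSq_flow hrun m n]; ring

/-! ## §3 Node U6's Cauchy sum from the stretched shape -/

/-- **NODE U6'S TRANSPORTED TOTAL IS SUMMABLE WITHOUT `FadingMemory`.**  Under the stretched shape, for `E ≥ 0` and a contraction
`0 ≤ ρ < 1`, `T4CauchySum.delta E ρ (fun K j ↦ disc (g K) (g (K+1)) j)` is summable over the cutoff `K` — the conclusion of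
`T4CauchySum.summable_delta`, there derived from `InjectedRate C c θ`.  (`2K+2 ≤ 2(j+1)(n+1)` on the antidiagonal `j + n = K`, so
`delta ≤ 2ED·Σ_{j+n=K} [(j+1)r^(Nat.sqrt j)]·[(n+1)ρ^n]`, a Cauchy product of two summable nonnegative sequences.) [folklore] -/
theorem summable_delta_of_stretched {E ρ : ℝ} (hD : 0 ≤ D) (hr0 : 0 ≤ r) (hr1 : r < 1) (hE : 0 ≤ E)
    (hρ0 : 0 ≤ ρ) (hρ1 : ρ < 1)
    (hstr : ∀ K j, j ≤ K → disc (g K) (g (K + 1)) j ≤ D * (2 * K + 2) * r ^ Nat.sqrt j) :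
    Summable (delta E ρ (fun K j => disc (g K) (g (K + 1)) j)) := by
  set f : ℕ → ℝ := fun j => ((j : ℝ) + 1) * r ^ Nat.sqrt j with hf
  set h : ℕ → ℝ := fun n => ((n : ℝ) + 1) * ρ ^ n with hh
  have hfs : Summable f := summable_succ_mul_pow_sqrt hr0 hr1
  have hhs : Summable h := by simpa [hh, pow_one] using summable_succ_pow_mul_geometric hρ0 hρ1 1
  have hf0 : 0 ≤ f := fun j => by simp only [hf]; positivity
  have hh0 : 0 ≤ h := fun n => by simp only [hh]; positivity
  have hprod := summable_sum_mul_antidiagonal_of_summable_mul (Summable.mul_of_nonneg hfs hhs hf0 hh0)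
  refine Summable.of_nonneg_of_le (fun K => ?_) (fun K => ?_) (hprod.mul_left (2 * E * D))
  · unfold delta
    refine mul_nonneg hE (sum_nonneg fun p hp => mul_nonneg (disc_nonneg _ _ _) (pow_nonneg hρ0 _))
  · unfold delta
    have hterm : ∀ p ∈ antidiagonal K, disc (g K) (g (K + 1)) p.1 * ρ ^ p.2 ≤ 2 * D * (f p.1 * h p.2) := by
      intro p hp
      have hpK : p.1 + p.2 = K := mem_antidiagonal.mp hp
      have hj : p.1 ≤ K := by omega
      have h1 := hstr K p.1 hj
      have hK2 : (2 * (K : ℝ) + 2) ≤ 2 * (((p.1 : ℝ) + 1) * ((p.2 : ℝ) + 1)) := by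
        have e : (K : ℝ) = (p.1 : ℝ) + (p.2 : ℝ) := by rw [← hpK]; push_cast; ring
        rw [e]; nlinarith [(Nat.cast_nonneg p.1 : (0 : ℝ) ≤ (p.1 : ℝ)), (Nat.cast_nonneg p.2 : (0 : ℝ) ≤ (p.2 : ℝ))]
      calc disc (g K) (g (K + 1)) p.1 * ρ ^ p.2 ≤ D * (2 * K + 2) * r ^ Nat.sqrt p.1 * ρ ^ p.2 :=
            mul_le_mul_of_nonneg_right h1 (pow_nonneg hρ0 _)
        _ ≤ D * (2 * (((p.1 : ℝ) + 1) * ((p.2 : ℝ) + 1))) * r ^ Nat.sqrt p.1 * ρ ^ p.2 :=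
            mul_le_mul_of_nonneg_right (mul_le_mul_of_nonneg_right (mul_le_mul_of_nonneg_left hK2 hD) (pow_nonneg hr0 _))
              (pow_nonneg hρ0 _)
        _ = 2 * D * (f p.1 * h p.2) := by simp only [hf, hh]; ring
    calc E * ∑ p ∈ antidiagonal K, disc (g K) (g (K + 1)) p.1 * ρ ^ p.2
        ≤ E * ∑ p ∈ antidiagonal K, 2 * D * (f p.1 * h p.2) := mul_le_mul_of_nonneg_left (sum_le_sum hterm) hE
      _ = 2 * E * D * ∑ p ∈ antidiagonal K, f p.1 * h p.2 := by rw [← mul_sum]; ring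

/-- **NODE U6'S CAUCHY SUM, ASSEMBLED, WITHOUT `FadingMemory`** — `T4CauchySum.cauchySum` with its source hypothesis
`InjectedRate C c θ inj` REPLACED by the stretched shape of (E33c): with node U5 as `MatchingModConstants vol l₀ (delta E ρ disc) Z`,
the transported totals are summable, consecutive generating functions differ by `≤ 2·vol·δ_K` on `|t| ≤ l₀`, every
`K ↦ genFun Z K t` is Cauchy and the convergence to `genFunLim Z` is uniform on the closed `l₀`-ball (node U6's own
`abs_genFun_succ_sub_le` ∕ `cauchySeq_genFun` ∕ `tendstoUniformlyOn_genFun` BY NAME — they consume only `Summable δ`).  A CONDITIONAL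
kernel theorem on NOT-IN-PRINT shapes, exactly as node U6's. [folklore] -/
theorem cauchySum_of_stretched {E ρ vol l₀ : ℝ} {Z : ℕ → ℝ → ℝ} (hD : 0 ≤ D) (hr0 : 0 ≤ r) (hr1 : r < 1) (hE : 0 ≤ E)
    (hρ0 : 0 ≤ ρ) (hρ1 : ρ < 1) (hl₀ : 0 ≤ l₀)
    (hstr : ∀ K j, j ≤ K → disc (g K) (g (K + 1)) j ≤ D * (2 * K + 2) * r ^ Nat.sqrt j)
    (hU5 : MatchingModConstants vol l₀ (delta E ρ (fun K j => disc (g K) (g (K + 1)) j)) Z) :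
    Summable (delta E ρ (fun K j => disc (g K) (g (K + 1)) j)) ∧
    (∀ K : ℕ, ∀ t : ℝ, |t| ≤ l₀ →
      |genFun Z (K + 1) t - genFun Z K t| ≤ 2 * (vol * delta E ρ (fun K j => disc (g K) (g (K + 1)) j) K)) ∧
    (∀ t : ℝ, |t| ≤ l₀ → CauchySeq fun K => genFun Z K t) ∧
    TendstoUniformlyOn (fun K t => genFun Z K t) (genFunLim Z) atTop {t | |t| ≤ l₀} := by
  have hδ := summable_delta_of_stretched hD hr0 hr1 hE hρ0 hρ1 hstr
  exact ⟨hδ, fun K t ht => abs_genFun_succ_sub_le hU5 hl₀ K ht, fun t ht => cauchySeq_genFun hU5 hl₀ hδ ht,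
    tendstoUniformlyOn_genFun hU5 hl₀ hδ⟩

/-! ## §4 Ends from the binders — NO `FadingMemory` -/

/-- **THE CONTINUUM RECURSION VARIABLE EXISTS WITHOUT FADING MEMORY — SIGN FORM.**  A family of runs `K ↦ g K` of (0.20) (`K` steps, all in
]0,γ], all pinned at the same renormalized coupling `g K K = g_IR`) with ONE history family `β` under: NE4 as `ScaleShiftRate c θ γ β`
(`c ≥ 0`, `0 ≤ θ < 1`); `HistLipschitz Λ γ β`, `Λ ≥ 0`, with ONLY the k-uniform ROW total weight `Σ_{i≤k} Λ k i ≤ M`; the sign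
`BetaLowerH 0 γ β`; the eventual floor `EventualLowerH b γ k₀ β` (`b > 0`); SMALLNESS `M·U < 1`, `U = (k₀+1)γ³ + 2γ∕b`.  THEN at every
infrared distance `m`: the consecutive-cutoff discrepancies are summable AND `1∕(g (n+m) n)² → astar g m`.  ((E33c)
`disc_le_stretched_sign` BY NAME + §2.)  Binders NOT PRINTED, never facts. [cite: Balaban1987RG1, (0.20) p.256 and (0.31) p.259] -/
theorem continuum_of_sign {b c θ M : ℝ} {k₀ : ℕ} {Λ : ℕ → ℕ → ℝ}
    (hγ : 0 < γ) (hb : 0 < b) (hc : 0 ≤ c) (hθ0 : 0 ≤ θ) (hθ1 : θ < 1)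
    (hrun : ∀ K, RGEqH K β (g K)) (hbox : ∀ K i, i ≤ K → 0 < g K i ∧ g K i ≤ γ) (hpin : ∀ K, g K K = gIR)
    (hS : ScaleShiftRate c θ γ β) (hL : HistLipschitz Λ γ β) (hΛ : ∀ k i, i ≤ k → 0 ≤ Λ k i) (hM : 0 ≤ M)
    (hrow : ∀ k, ∑ i ∈ range (k + 1), Λ k i ≤ M)
    (hsign : BetaLowerH 0 γ β) (hlo : EventualLowerH b γ k₀ β)
    (hsmall : M * (((k₀ : ℝ) + 1) * γ ^ 3 + 2 * γ / b) < 1) (m : ℕ) :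
    Summable (fun n : ℕ => disc (g (n + m)) (g (n + m + 1)) n) ∧ Tendsto (invSq g m) atTop (𝓝 (astar g m)) := by
  set q := M * (((k₀ : ℝ) + 1) * γ ^ 3 + 2 * γ / b) with hq
  have hq0 : 0 ≤ q := mul_nonneg hM (by positivity)
  have hD : 0 ≤ c / ((1 - θ) * (1 - q)) := div_nonneg hc (mul_nonneg (by linarith) (by linarith))
  have hr0 : 0 ≤ max θ q := hθ0.trans (le_max_left _ _)
  have hr1 : max θ q < 1 := max_lt hθ1 hsmall
  have hstr : ∀ K j, j ≤ K → disc (g K) (g (K + 1)) j ≤ c / ((1 - θ) * (1 - q)) * (2 * K + 2) * (max θ q) ^ Nat.sqrt j :=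
    fun K j hj => disc_le_stretched_sign hγ hb hc hθ0 hθ1 (hrun K) (hrun (K + 1)) (hbox K) (hbox (K + 1))
      (by rw [hpin K, hpin (K + 1)]) hS hL hΛ hM hrow hsign hlo hsmall j hj
  exact ⟨summable_disc_of_stretched hD hr0 hr1 hstr m, tendsto_invSq_of_stretched hD hr0 hr1 hstr m⟩

/-- **NODE U6'S CAUCHY SUM WITHOUT FADING MEMORY — SIGN FORM**: under the binders of `continuum_of_sign`, for every `E ≥ 0` and
contraction `0 ≤ ρ < 1`, `T4CauchySum.delta E ρ (fun K j ↦ disc (g K) (g (K+1)) j)` is summable over the cutoff.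
[cite: Balaban1987RG1, (0.20) p.256 and (0.31) p.259] -/
theorem summable_delta_of_sign {b c θ M E ρ : ℝ} {k₀ : ℕ} {Λ : ℕ → ℕ → ℝ}
    (hγ : 0 < γ) (hb : 0 < b) (hc : 0 ≤ c) (hθ0 : 0 ≤ θ) (hθ1 : θ < 1) (hE : 0 ≤ E) (hρ0 : 0 ≤ ρ) (hρ1 : ρ < 1)
    (hrun : ∀ K, RGEqH K β (g K)) (hbox : ∀ K i, i ≤ K → 0 < g K i ∧ g K i ≤ γ) (hpin : ∀ K, g K K = gIR)
    (hS : ScaleShiftRate c θ γ β) (hL : HistLipschitz Λ γ β) (hΛ : ∀ k i, i ≤ k → 0 ≤ Λ k i) (hM : 0 ≤ M)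
    (hrow : ∀ k, ∑ i ∈ range (k + 1), Λ k i ≤ M)
    (hsign : BetaLowerH 0 γ β) (hlo : EventualLowerH b γ k₀ β)
    (hsmall : M * (((k₀ : ℝ) + 1) * γ ^ 3 + 2 * γ / b) < 1) :
    Summable (delta E ρ (fun K j => disc (g K) (g (K + 1)) j)) := by
  set q := M * (((k₀ : ℝ) + 1) * γ ^ 3 + 2 * γ / b) with hq
  have hq0 : 0 ≤ q := mul_nonneg hM (by positivity)
  have hD : 0 ≤ c / ((1 - θ) * (1 - q)) := div_nonneg hc (mul_nonneg (by linarith) (by linarith))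
  have hr0 : 0 ≤ max θ q := hθ0.trans (le_max_left _ _)
  have hr1 : max θ q < 1 := max_lt hθ1 hsmall
  have hstr : ∀ K j, j ≤ K → disc (g K) (g (K + 1)) j ≤ c / ((1 - θ) * (1 - q)) * (2 * K + 2) * (max θ q) ^ Nat.sqrt j :=
    fun K j hj => disc_le_stretched_sign hγ hb hc hθ0 hθ1 (hrun K) (hrun (K + 1)) (hbox K) (hbox (K + 1))
      (by rw [hpin K, hpin (K + 1)]) hS hL hΛ hM hrow hsign hlo hsmall j hj
  exact summable_delta_of_stretched hD hr0 hr1 hE hρ0 hρ1 hstr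

/-- **THE CONTINUUM RECURSION VARIABLE EXISTS WITHOUT FADING MEMORY — EVENTUAL FORM** (no sign): the same family under
`ScaleShiftRate c θ γ β`, `HistLipschitz Λ γ β` with rows `≤ M`, the eventual floor `EventualLowerH b γ k₀ β` (`b > 0`), the lower half
`β ≥ −β′` of the PRINTED-type two-sided bound (p. 264 «uniformly bounded», constant unprinted), `k₀β′γ² ≤ 1∕2`, and the SMALLNESS
`2√2·M·U < 1`.  THEN at every infrared distance `m`: summable consecutive-cutoff discrepancies, `1∕(g (n+m) n)² → astar g m`, and the
limit flow `β n (g (n+m+1))_{0..n} → astar g (m+1) − astar g m`.  ((E33c) `disc_le_stretched_eventual` BY NAME + §2.)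
[cite: Balaban1987RG1, (0.20) p.256 and §1 p.264] -/
theorem continuum_of_eventual {b β' c θ M : ℝ} {k₀ : ℕ} {Λ : ℕ → ℕ → ℝ}
    (hγ : 0 < γ) (hb : 0 < b) (hc : 0 ≤ c) (hθ0 : 0 ≤ θ) (hθ1 : θ < 1)
    (hrun : ∀ K, RGEqH K β (g K)) (hbox : ∀ K i, i ≤ K → 0 < g K i ∧ g K i ≤ γ) (hpin : ∀ K, g K K = gIR)
    (hS : ScaleShiftRate c θ γ β) (hL : HistLipschitz Λ γ β) (hΛ : ∀ k i, i ≤ k → 0 ≤ Λ k i) (hM : 0 ≤ M)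
    (hrow : ∀ k, ∑ i ∈ range (k + 1), Λ k i ≤ M)
    (hlo : EventualLowerH b γ k₀ β) (hβ' : 0 ≤ β') (hlow : ∀ k v, v ∈ Box γ k → -β' ≤ β k v)
    (hk₀ : (k₀ : ℝ) * β' * γ ^ 2 ≤ 1 / 2)
    (hsmall : 2 * Real.sqrt 2 * M * (((k₀ : ℝ) + 1) * γ ^ 3 + 2 * γ / b) < 1) (m : ℕ) :
    Summable (fun n : ℕ => disc (g (n + m)) (g (n + m + 1)) n) ∧ Tendsto (invSq g m) atTop (𝓝 (astar g m))
      ∧ Tendsto (fun n => β n (prefixOf (g (n + m + 1)) n)) atTop (𝓝 (astar g (m + 1) - astar g m)) := by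
  set q := 2 * Real.sqrt 2 * M * (((k₀ : ℝ) + 1) * γ ^ 3 + 2 * γ / b) with hq
  have hq0 : 0 ≤ q := mul_nonneg (mul_nonneg (mul_nonneg (by norm_num) (Real.sqrt_nonneg 2)) hM) (by positivity)
  have hD : 0 ≤ c / ((1 - θ) * (1 - q)) := div_nonneg hc (mul_nonneg (by linarith) (by linarith))
  have hr0 : 0 ≤ max θ q := hθ0.trans (le_max_left _ _)
  have hr1 : max θ q < 1 := max_lt hθ1 hsmall
  have hstr : ∀ K j, j ≤ K → disc (g K) (g (K + 1)) j ≤ c / ((1 - θ) * (1 - q)) * (2 * K + 2) * (max θ q) ^ Nat.sqrt j :=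
    fun K j hj => disc_le_stretched_eventual hγ hb hc hθ0 hθ1 (hrun K) (hrun (K + 1)) (hbox K) (hbox (K + 1))
      (by rw [hpin K, hpin (K + 1)]) hS hL hΛ hM hrow hlo hβ' hlow hk₀ hsmall j hj
  exact ⟨summable_disc_of_stretched hD hr0 hr1 hstr m, tendsto_invSq_of_stretched hD hr0 hr1 hstr m,
    tendsto_beta_diag_of_stretched hD hr0 hr1 hstr hrun m⟩

end Summit.QuantumFields.BalabanUV.Beta.EriceRemainderEnclosureHistoryRenewalContinuum

end
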